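import Literature.AlgebraicGeometry.HodgeTheory.SemiregularityEulerFormBarrier
import Mathlib.Data.ZMod.Basic
import Mathlib.Tactic
import HarnessLib

/-!
# Venture HSemireg — THEOREM (B-XIX)(a)(d) AT n = 4 (g = 8, family B), ONE FACTOR: the EdGFS parity sieve `𝒫₄` on character
# vectors `(v₀,…,v₄)` is a SUBRING mod 2 (closed under twists by ANY sieved character), `R₄ = 𝒫₄` (the sieve is sharp at n = 4),
# and the BOX CELLS `pe(d)` ∕ `po(d)` — kernel statements of integer ∕ `𝔽₂` arithmetic

HONEST FRAMING. Part of the Lean index of the computation cell `pub-hsemireg` (Sunday typer seat p9, § g = 8; companion of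
`CensusG8Table.lean` ∕ `CensusG8Verdict.lean`, census row **B19-21**; second half = `ParitySieveTwoFactor.lean`). FINITE ARITHMETIC
ONLY: integer vectors `Fin 5 → ℤ` («one-factor characters `v = Σ v_i Θ^i∕i!` of objects on a ppav FOURFOLD»), parity conditions on
them, and explicit (bi)linear operations. No variety, sheaf, Chern character, Fourier–Mukai functor or semiregularity map is
constructed; the hypothesis (I1) below is NOT a binder of any theorem here (it lives in the dictionary only); nothing here says that
HC ∕ HC_CM ∕ HC_AV holds; no object is certified; no Literature fact is declared. Numbers, not adjectives.

TEXTS OF RECORD (quoted, not interpreted). Source: t-19 g7, `target-g8/BISECANT-G8-t19g7.md` v1.3 `68df8c98ce5a70b7` (§2 THEOREM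
(B-XIX), §3 «S₄ = border-𝒫₄ — hand proof (machine-confirmed)», §10 Lean check), numbers identical since v1.0 `258c9a02e9e2e94f`;
census row B19-21 of `target-g8/CENSUS.md` v1.274 `7744dc4867915f69`; STRUCTURE.md v1.0 §2 (B-XIX) NOTE (v0.46); starting point =
t-19 g7's folder-local kernel file `target-g8/t19g7/lean/TwoFactorSieve.lean` `1f2b1f702b73cbf4` (13 theorems, farm rc 0 ×2 seats:
t-19 g7, t-21 g7), whose §1 (I4) dictionary reads: «my one-factor v = (v₀,…,v₄) and maps T, Φ are exactly those [of the tree's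
`paritySieve_T_stable` ∕ `paritySieve_Phi_stable`]; 𝒫₄ of (B-XIX)(a) = `paritySieve` mod 2 … the dictionary is for the Lean-side successor».
* (B-XIX) SETTING (§2): «X … principally polarised abelian varieties of dimension n ≥ 4 over ℂ with NS = ℤΘ …; u_i := Θ^i∕i!;
  u_i·u_k = C(i+k,i) u_{i+k}. For G ∈ D^b write ch(G) = Σ v_i u_i (v is INTEGRAL for every object) … T := ⊗O(Θ) acts by v ↦ P v,
  P_{ik} = C(i,k) (binomial transform); Φ := Fourier–Mukai … acts by u_i ↦ (−1)^i u_{n−i} up to a global sign … twist by N: M(n̄)_{ik} =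
  C(i,k) n̄_{i−k}, n̄ = ch(N). HYPOTHESIS (I1)_X: every algebraic class in H^{2c}(X,ℤ), 2 ≤ c ≤ n−1, is an even multiple of u_c»
  ((I1) = the conclusion of [EdGFS25] Engel–de Gaay Fortman–Schreieder, arXiv:2507.15704 Thm 1.1, a PREPRINT — cited as an unrefereed
  2025 claim in the Literature file imported here; every geometric consequence is CONDITIONAL on it and is prose only).
* (B-XIX)(a) at n = 4: «If (I1)_X holds then for every G ∈ D^b(X): (v mod 2) ∈ 𝒫_n … 𝒫₄ = {v₁≡v₂≡v₃} ✓ = tree … REALISABLE RESIDUES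
  R_n := 𝔽₂-span of ch(N) mod 2 over the objects generated from O_X and k(x) by T^{±1}, Φ, ⊕, shifts, ⊗: R_n = ⟨e₀, e_n, (0,1,1,…,1,0)⟩,
  dim 3, R_n ⊆ 𝒫_n for all n (consistency ✓), R₄ = 𝒫₄ [the sieve is SHARP at n = 4]». §3: «𝒫₄ = ⟨e₀, e₄, f = (0,1,1,1,0)⟩ is a
  SUBRING mod 2: e₀ is the unit, e₄∗f = e₄∗e₄ = 0, (f∗f)₂ = 2, (f∗f)₃ = 6, (f∗f)₄ = 4+6+4 = 14, all even ⇒ f∗f ≡ 0».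
* (B-XIX)(d) BOX CELLS: «v(e^{aΘ}pe(d)) = P^a·pe(d); 𝒫_n is P-stable and P̄ is invertible, so the verdict is that of pe(d) =
  (1, 0, −d, 0, d², …): v₁ = 0, v₂ = −d ⇒ fails ⟺ d odd; po(d) = (0, 1, 0, −d, 0, …): v₁ = 1, v₂ = 0 ⇒ fails for every d, every a,
  every n ≥ 4». (pe(d) = Σ_{i even}(−d)^{i∕2}u_i, po(d) = Σ_{i odd}(−d)^{(i−1)∕2}u_i — the family-B characters of (B-XIX)(c).)

WHAT THIS FILE PROVES (kernel; `omega` for the linear parities, `decide` over `ZMod 2` for the bilinear ones, ≤ 2⁸ residue cases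
each). `sieve` := `v₁ ≡ v₂ ≡ v₃ (mod 2)` — literally the tree's `paritySieve` shape; `sieve_T_iff` ∕ `sieve_Phi_iff` ARE the
Literature's `paritySieve_T_stable` ∕ `paritySieve_Phi_stable` re-read on vectors (no new vocabulary for the one-factor sieve). NEW:
`sieve_thetaMul` — `𝒫₄` is closed under the truncated product `(a ⋆ b)_i = Σ_k C(i,k) a_k b_{i−k}` in the basis `Θ^i∕i!` (= the §3
«SUBRING mod 2»: twist by ANY sieved character, not only by `e^Θ` and `pt`); `thetaMul_expTheta` (`e^Θ ⋆ w = T w`);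
`sieve_iff_exists_residue` (R₄ = 𝒫₄: a vector is sieved iff it is `≡ a·1 + b·e^Θ + c·pt (mod 2)` coordinatewise);
`sieve_expPow_mul_iff` ∕ `sieve_thetaMul_iff_of_unit` (twists by `e^{aΘ}`, indeed by any sieved UNIT `n̄`, `n̄₀` odd, do not
change the verdict — `n̄` is an involution mod 2, `thetaMul_thetaMul_congr`); `sieve_smul_iff_of_odd`;
`sieve_iff_forall_reach_chern_even` — (B-XIX)(a)'s ORBIT DEFINITION of `𝒫₄` («for every g in ⟨P̄, J̄⟩
the Chern coefficients w_c(g v̄), 2 ≤ c ≤ 3, are even», `chern2 ∕ chern3` by Newton's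
recursion, orbit = `Reach`) is EQUIVALENT to the closed form, the generation step being the tree's `paritySieve_of_conjugates`; the box
cells `sieve_pe_iff` (`pe(d)` sieved ⟺ `d` even), `not_sieve_po`, their twisted versions, and `boxCells_d_one` (t-19 g7's `boxCells_fail`).

WHAT IS NOT HERE. The DICTIONARY (objects, `ch`, twists, Fourier–Mukai, the integrality of `ch` on tori, (I1)) — prose of record
above, not asserted; the codes `𝒫_n` for n ≥ 5 and `R_n ⊊ 𝒫_n` there (machine tables `runs/sieve2.log`); whether the residues of
`𝒫_n ∖ R_n` are characters of objects (not decided in the text either). Everything here is at n = 4 only (5 coefficients).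
-/

namespace Summit.Ventures.HSemireg.ParitySieve

open Literature.AlgebraicGeometry.HodgeTheory

/-! ## §0 Parity bookkeeping: `x % 2 = 0` versus the residue in `ZMod 2` -/

/-- `x ≡ 0 (mod 2)` as printed (`x % 2 = 0`, the shape of the tree's `paritySieve_*` lemmas) iff the residue of `x` in `ZMod 2`
vanishes. [bookkeeping] -/
theorem emod_two_eq_zero_iff_cast (x : ℤ) : x % 2 = 0 ↔ (x : ZMod 2) = 0 := by
  rw [ZMod.intCast_zmod_eq_zero_iff_dvd]
  constructor
  · intro h; exact Int.dvd_of_emod_eq_zero (by exact_mod_cast h)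
  · intro h; exact Int.emod_eq_zero_of_dvd (by exact_mod_cast h)

/-- `x ≡ y (mod 2)` as printed iff the residues agree in `ZMod 2`. [bookkeeping] -/
theorem emod_two_sub_iff (x y : ℤ) : (x - y) % 2 = 0 ↔ (x : ZMod 2) = (y : ZMod 2) := by
  rw [emod_two_eq_zero_iff_cast]; push_cast; exact sub_eq_zero

/-- An odd integer has residue `1` in `ZMod 2`. [bookkeeping] -/
theorem cast_eq_one_of_emod_two (x : ℤ) (h : x % 2 = 1) : (x : ZMod 2) = 1 := by
  have hx : x = 2 * (x / 2) + 1 := by omega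
  rw [hx]; push_cast
  rw [show (2 : ZMod 2) = 0 from by decide]
  simp

/-! ## §1 One factor: the sieve `𝒫₄` on character vectors `v = (v₀, …, v₄)`, `ch = Σ v_i Θ^i∕i!` -/

/-- The one-factor EdGFS parity sieve at n = 4, `𝒫₄ : v₁ ≡ v₂ ≡ v₃ (mod 2)` — literally the conjunction
`(v₁ − v₂) % 2 = 0 ∧ (v₂ − v₃) % 2 = 0` of the tree's `paritySieve_T_stable` ∕ `paritySieve_Phi_stable` ∕ `paritySieve_of_conjugates`
(Literature `SemiregularityEulerFormBarrier.lean`), read on a vector `Fin 5 → ℤ`. (B-XIX)(a): «𝒫₄ = {v₁≡v₂≡v₃} (= tree `paritySieve`)».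
A decidable predicate of the finite model, not a fact. [bookkeeping; transcription of the tree's shape] -/
def sieve (w : Fin 5 → ℤ) : Prop := (w 1 - w 2) % 2 = 0 ∧ (w 2 - w 3) % 2 = 0

/-- The sieve is decidable (two integer congruences). [bookkeeping] -/
instance (w : Fin 5 → ℤ) : Decidable (sieve w) := inferInstanceAs (Decidable (_ ∧ _))

/-- The sieve read in residues: `v̄₁ = v̄₂ ∧ v̄₂ = v̄₃` in `ZMod 2`. [bookkeeping] -/
theorem sieve_iff_cast (w : Fin 5 → ℤ) : sieve w ↔ ((w 1 : ZMod 2) = w 2 ∧ (w 2 : ZMod 2) = w 3) := by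
  simp only [sieve, emod_two_sub_iff]

/-- `T = ⊗𝒪(Θ)`: multiplication by `e^Θ` in the basis `Θ^i∕i!`, `(T v)_i = Σ_k C(i,k) v_k` (binomial transform; the text's `P v`).
Same coordinates as the tree's `paritySieve_T_stable`. [bookkeeping; transcription] -/
def T (w : Fin 5 → ℤ) : Fin 5 → ℤ :=
  ![w 0, w 0 + w 1, w 0 + 2 * w 1 + w 2, w 0 + 3 * w 1 + 3 * w 2 + w 3, w 0 + 4 * w 1 + 6 * w 2 + 4 * w 3 + w 4]

/-- `Φ` = cohomological Fourier–Mukai on a ppav fourfold in the basis `Θ^i∕i!`: `u_i ↦ (−1)^i u_{4−i}` (global sign irrelevant for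
parities), i.e. `Φ v = (v₄, −v₃, v₂, −v₁, v₀)` — the coordinates of the tree's `paritySieve_Phi_stable` (the text's `J v`).
[bookkeeping; transcription] -/
def Phi (w : Fin 5 → ℤ) : Fin 5 → ℤ := ![w 4, -w 3, w 2, -w 1, w 0]

/-- The truncated product of characters in the basis `u_i = Θ^i∕i!` on a fourfold: `u_i · u_k = C(i+k, i) u_{i+k}` (zero past degree 4),
so `(a ⋆ b)_i = Σ_k C(i,k) a_k b_{i−k}` — the text's `M(n̄) v` ∕ `v ∗ n̄` (`ch(G ⊗ N) = ch G · ch N`). [bookkeeping; transcription] -/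
def thetaMul (a b : Fin 5 → ℤ) : Fin 5 → ℤ :=
  ![a 0 * b 0, a 0 * b 1 + a 1 * b 0, a 0 * b 2 + 2 * a 1 * b 1 + a 2 * b 0,
    a 0 * b 3 + 3 * a 1 * b 2 + 3 * a 2 * b 1 + a 3 * b 0,
    a 0 * b 4 + 4 * a 1 * b 3 + 6 * a 2 * b 2 + 4 * a 3 * b 1 + a 4 * b 0]

/-- `1 = ch(𝒪_X) = e₀ = (1,0,0,0,0)`. [bookkeeping] -/
def one : Fin 5 → ℤ := ![1, 0, 0, 0, 0]

/-- `e^Θ = ch(𝒪(Θ)) = (1,1,1,1,1)` in the basis `Θ^i∕i!`. [bookkeeping] -/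
def expTheta : Fin 5 → ℤ := ![1, 1, 1, 1, 1]

/-- `e^{aΘ} = ch(𝒪(aΘ)) = (1, a, a², a³, a⁴)` in the basis `Θ^i∕i!`, `a ∈ ℤ`. [bookkeeping] -/
def expPow (a : ℤ) : Fin 5 → ℤ := ![1, a, a ^ 2, a ^ 3, a ^ 4]

/-- `pt = ch(k(x)) = e₄ = (0,0,0,0,1)` (the point class `u₄`). [bookkeeping] -/
def pt : Fin 5 → ℤ := ![0, 0, 0, 0, 1]

/-- The family-B even character `pe(d) = Σ_{i even} (−d)^{i∕2} u_i = (1, 0, −d, 0, d²)` at n = 4 ((B-XIX)(c)∕(d)). [bookkeeping;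
transcription] -/
def pe (d : ℤ) : Fin 5 → ℤ := ![1, 0, -d, 0, d ^ 2]

/-- The family-B odd character `po(d) = Σ_{i odd} (−d)^{(i−1)∕2} u_i = (0, 1, 0, −d, 0)` at n = 4 ((B-XIX)(c)∕(d)). [bookkeeping;
transcription] -/
def po (d : ℤ) : Fin 5 → ℤ := ![0, 1, 0, -d, 0]

section OneFactor

variable (w a b : Fin 5 → ℤ)

/-- **`𝒫₄` is `T`-stable, as an iff** — this IS the tree's `paritySieve_T_stable` read on the vector `w`. [bookkeeping; cited
Literature lemma: `Literature.AlgebraicGeometry.HodgeTheory.paritySieve_T_stable`] -/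
theorem sieve_T_iff : sieve (T w) ↔ sieve w := by
  have h := paritySieve_T_stable (w 0) (w 1) (w 2) (w 3)
  simp only [sieve, T, Matrix.cons_val_one, Matrix.head_cons, Matrix.cons_val_two, Matrix.tail_cons,
    Matrix.cons_val_three]
  exact h.symm

/-- **`𝒫₄` is `Φ`-stable, as an iff** — this IS the tree's `paritySieve_Phi_stable` read on the vector `w`. [bookkeeping; cited
Literature lemma: `Literature.AlgebraicGeometry.HodgeTheory.paritySieve_Phi_stable`] -/
theorem sieve_Phi_iff : sieve (Phi w) ↔ sieve w := by
  have h := paritySieve_Phi_stable (w 1) (w 2) (w 3)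
  simp only [sieve, Phi, Matrix.cons_val_one, Matrix.head_cons, Matrix.cons_val_two, Matrix.tail_cons,
    Matrix.cons_val_three]
  exact h.symm

/-- `𝒫₄` is a subgroup: closed under `+`. [bookkeeping] -/
theorem sieve_add (ha : sieve a) (hb : sieve b) : sieve (a + b) := by
  simp only [sieve, Pi.add_apply] at ha hb ⊢; omega

/-- `𝒫₄` is closed under `−`. [bookkeeping] -/
theorem sieve_neg (ha : sieve a) : sieve (-a) := by
  simp only [sieve, Pi.neg_apply] at ha ⊢; omega

/-- `𝒫₄` is closed under subtraction. [bookkeeping] -/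
theorem sieve_sub (ha : sieve a) (hb : sieve b) : sieve (a - b) := by
  simp only [sieve, Pi.sub_apply] at ha hb ⊢; omega

/-- The zero character is sieved. [bookkeeping] -/
theorem sieve_zero : sieve (0 : Fin 5 → ℤ) := by
  simp only [sieve, Pi.zero_apply]; decide

/-- Every EVEN vector is sieved (the sieve is a condition on residues). [bookkeeping] -/
theorem sieve_of_even (h1 : w 1 % 2 = 0) (h2 : w 2 % 2 = 0) (h3 : w 3 % 2 = 0) : sieve w := by
  simp only [sieve]; omega

/-- `2 • w` is sieved for every `w`. [bookkeeping] -/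
theorem sieve_two_smul : sieve ((2 : ℤ) • w) := by
  simp only [sieve, Pi.smul_apply, smul_eq_mul]; omega

/-- `𝒫₄` is closed under integer scalars: `c • w` is sieved when `w` is. [bookkeeping] -/
theorem sieve_smul (c : ℤ) (hw : sieve w) : sieve (c • w) := by
  rw [sieve_iff_cast] at hw ⊢
  simp only [Pi.smul_apply, smul_eq_mul]
  push_cast
  rw [hw.1, hw.2]; exact ⟨rfl, rfl⟩

/-- Residue form of `sieve_thetaMul`: the two parity identities, all 2⁸ residue patterns. [bookkeeping] -/
private theorem thetaMul_aux : ∀ a0 a1 a2 a3 b0 b1 b2 b3 : ZMod 2, a1 = a2 → a2 = a3 → b1 = b2 → b2 = b3 →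
    (a0 * b1 + a1 * b0 = a0 * b2 + 2 * a1 * b1 + a2 * b0 ∧
      a0 * b2 + 2 * a1 * b1 + a2 * b0 = a0 * b3 + 3 * a1 * b2 + 3 * a2 * b1 + a3 * b0) := by
  decide

/-- **«𝒫₄ is a SUBRING mod 2» (§3 hand proof):** the sieve is closed under the truncated product `⋆` in the basis `Θ^i∕i!` — i.e.
under the twist by ANY sieved character `n̄` (not only `e^Θ` and `pt`). Proof: the two parity identities in the eight residues
`ā₀…ā₃, b̄₀…b̄₃`, by `decide` over `ZMod 2`. [bookkeeping; kernel form of a hand sentence of BISECANT-G8-t19g7.md §3] -/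
theorem sieve_thetaMul {a b : Fin 5 → ℤ} (ha : sieve a) (hb : sieve b) : sieve (thetaMul a b) := by
  rw [sieve_iff_cast] at ha hb ⊢
  simp only [thetaMul, Matrix.cons_val_one, Matrix.head_cons, Matrix.cons_val_two, Matrix.tail_cons,
    Matrix.cons_val_three]
  push_cast
  exact thetaMul_aux _ _ _ _ _ _ _ _ ha.1 ha.2 hb.1 hb.2

/-- The product is the text's `T` on `e^Θ`: `e^Θ ⋆ w = T w` (so `T`-stability is the instance `n̄ = e^Θ` of `sieve_thetaMul`).
[bookkeeping] -/
theorem thetaMul_expTheta : thetaMul expTheta w = T w := by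
  funext i
  fin_cases i <;> simp [thetaMul, expTheta, T] <;> ring

/-- `pt ⋆ w = (0,0,0,0,w₀)` = multiplication by the point class. [bookkeeping] -/
theorem thetaMul_pt : thetaMul pt w = ![0, 0, 0, 0, w 0] := by
  funext i
  fin_cases i <;> simp [thetaMul, pt]

/-- `1 ⋆ w = w`. [bookkeeping] -/
theorem thetaMul_one : thetaMul one w = w := by
  funext i
  fin_cases i <;> simp [thetaMul, one]

/-- The product is commutative. [bookkeeping] -/
theorem thetaMul_comm : thetaMul a b = thetaMul b a := by
  funext i
  fin_cases i <;> simp [thetaMul] <;> ring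

/-- `R₄ ⊆ 𝒫₄`: the three generating residues `1 = ch 𝒪`, `e^Θ = ch 𝒪(Θ)`, `pt = ch k(x)` are sieved. [bookkeeping] -/
theorem sieve_generators : sieve one ∧ sieve expTheta ∧ sieve pt := by
  simp only [sieve, one, expTheta, pt]; decide

/-- `e^{aΘ}` is sieved for every `a ∈ ℤ` (`a ≡ a² ≡ a³ (mod 2)`). [bookkeeping] -/
theorem sieve_expPow (c : ℤ) : sieve (expPow c) := by
  rw [sieve_iff_cast]
  simp only [expPow, Matrix.cons_val_zero, Matrix.cons_val_one, Matrix.head_cons, Matrix.cons_val_two,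
    Matrix.tail_cons, Matrix.cons_val_three]
  push_cast
  generalize (c : ZMod 2) = x
  revert x; decide

/-- **R₄ = 𝒫₄ («the sieve is SHARP at n = 4»):** a vector is sieved iff it is congruent mod 2, coordinatewise, to an integer
combination `a·1 + b·e^Θ + c·pt` of the three realisable generators (take `b = w₁`, `a = w₀ − w₁`, `c = w₄ − w₁`). [bookkeeping;
kernel form of (B-XIX)(a) «R₄ = 𝒫₄»] -/
theorem sieve_iff_exists_residue :
    sieve w ↔ ∃ a b c : ℤ, ∀ i, (w i - (a * one i + b * expTheta i + c * pt i)) % 2 = 0 := by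
  constructor
  · intro h
    refine ⟨w 0 - w 1, w 1, w 4 - w 1, ?_⟩
    simp only [sieve] at h
    intro i
    fin_cases i <;> simp [one, expTheta, pt] <;> omega
  · rintro ⟨a, b, c, h⟩
    have h1 := h 1; have h2 := h 2; have h3 := h 3
    simp only [one, expTheta, pt, Matrix.cons_val_zero, Matrix.cons_val_one, Matrix.head_cons, Matrix.cons_val_two,
      Matrix.tail_cons, Matrix.cons_val_three] at h1 h2 h3
    simp only [sieve]
    omega

/-- Residue form of `sieve_expPow_mul_iff`, all 2⁵ residue patterns. [bookkeeping] -/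
private theorem expPow_mul_aux : ∀ x w0 w1 w2 w3 : ZMod 2,
    ((w1 + x * w0 = w2 + 2 * x * w1 + x ^ 2 * w0 ∧
        w2 + 2 * x * w1 + x ^ 2 * w0 = w3 + 3 * x * w2 + 3 * x ^ 2 * w1 + x ^ 3 * w0) ↔ (w1 = w2 ∧ w2 = w3)) := by
  decide

/-- **Twists by `e^{aΘ}` do not change the verdict** ((B-XIX)(d): «𝒫_n is P-stable and P̄ is invertible, so the verdict is that of»
the untwisted vector): `e^{aΘ} ⋆ w` is sieved iff `w` is, for every `a ∈ ℤ`. [bookkeeping; `decide` over `ZMod 2`] -/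
theorem sieve_expPow_mul_iff (c : ℤ) : sieve (thetaMul (expPow c) w) ↔ sieve w := by
  rw [sieve_iff_cast, sieve_iff_cast]
  simp only [thetaMul, expPow, Matrix.cons_val_zero, Matrix.cons_val_one, Matrix.head_cons, Matrix.cons_val_two,
    Matrix.tail_cons, Matrix.cons_val_three, one_mul]
  push_cast
  exact expPow_mul_aux _ _ _ _ _

/-- Residue form of `sieve_smul_iff_of_odd`. [bookkeeping] -/
private theorem odd_smul_aux : ∀ r x1 x2 x3 : ZMod 2, r = 1 → ((r * x1 = r * x2 ∧ r * x2 = r * x3) ↔ (x1 = x2 ∧ x2 = x3)) := by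
  decide

/-- An ODD scalar multiple is sieved iff the vector is. [bookkeeping] -/
theorem sieve_smul_iff_of_odd (r : ℤ) (hr : r % 2 = 1) : sieve (r • w) ↔ sieve w := by
  rw [sieve_iff_cast, sieve_iff_cast]
  simp only [Pi.smul_apply, smul_eq_mul]
  push_cast
  exact odd_smul_aux _ _ _ _ (cast_eq_one_of_emod_two r hr)

/-- Residue form of `thetaMul_thetaMul_congr`: a sieved residue with odd head is an INVOLUTION of the truncated ring mod 2
(`(e₀ + b f + c e₄)² ≡ e₀`), coordinates 1, 2, 3. [bookkeeping] -/
private theorem unit_aux : ∀ n0 n1 n2 n3 x0 x1 x2 x3 : ZMod 2, n0 = 1 → n1 = n2 → n2 = n3 →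
    (n0 * (n0 * x1 + n1 * x0) + n1 * (n0 * x0) = x1 ∧
      n0 * (n0 * x2 + 2 * n1 * x1 + n2 * x0) + 2 * n1 * (n0 * x1 + n1 * x0) + n2 * (n0 * x0) = x2 ∧
      n0 * (n0 * x3 + 3 * n1 * x2 + 3 * n2 * x1 + n3 * x0) + 3 * n1 * (n0 * x2 + 2 * n1 * x1 + n2 * x0) +
          3 * n2 * (n0 * x1 + n1 * x0) + n3 * (n0 * x0) = x3) := by
  decide

/-- A sieved character with ODD rank (`n̄₀ = 1`: a unit of the truncated ring, e.g. `e^{aΘ}`, `ch` of any line-bundle twist of a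
sieved rank-odd object) acts as an involution mod 2: `n ⋆ (n ⋆ x) ≡ x` in coordinates 1, 2, 3. [bookkeeping; `decide` over `ZMod 2`] -/
theorem thetaMul_thetaMul_congr {n : Fin 5 → ℤ} (hn : sieve n) (h0 : n 0 % 2 = 1) (x : Fin 5 → ℤ) :
    ((thetaMul n (thetaMul n x) 1 : ℤ) : ZMod 2) = x 1 ∧ ((thetaMul n (thetaMul n x) 2 : ℤ) : ZMod 2) = x 2 ∧
      ((thetaMul n (thetaMul n x) 3 : ℤ) : ZMod 2) = x 3 := by
  rw [sieve_iff_cast] at hn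
  simp only [thetaMul, Matrix.cons_val_zero, Matrix.cons_val_one, Matrix.head_cons, Matrix.cons_val_two, Matrix.tail_cons,
    Matrix.cons_val_three]
  push_cast
  exact unit_aux _ _ _ _ _ _ _ _ (cast_eq_one_of_emod_two _ h0) hn.1 hn.2

/-- **Twists by sieved UNITS do not change the verdict:** if `n̄` is sieved with odd rank then `n ⋆ x` is sieved iff `x` is (the text's
«P̄ is invertible» for `e^Θ`, here for every sieved unit). [bookkeeping] -/
theorem sieve_thetaMul_iff_of_unit {n : Fin 5 → ℤ} (hn : sieve n) (h0 : n 0 % 2 = 1) (x : Fin 5 → ℤ) :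
    sieve (thetaMul n x) ↔ sieve x := by
  refine ⟨fun h => ?_, fun h => sieve_thetaMul hn h⟩
  have h2 := sieve_thetaMul hn h
  obtain ⟨e1, e2, e3⟩ := thetaMul_thetaMul_congr hn h0 x
  rw [sieve_iff_cast] at h2 ⊢
  rw [e1, e2, e3] at h2
  exact h2

/-! ### §1c The orbit definition of `𝒫₄` ((B-XIX)(a)) equals the closed form -/

/-- The codimension-2 Chern coefficient in RNC coordinates: `c₂(F) = w₂·Θ²∕2` with `w₂ = v₁² − v₂` (Newton's recursion of (B-XIX)(a);
the Literature file's «c₂(F) = (v₁² − v₂)·Θ²∕2»). [bookkeeping; transcription] -/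
def chern2 (w : Fin 5 → ℤ) : ℤ := w 1 * w 1 - w 2

/-- The codimension-3 Chern coefficient: `c₃(F) = w₃·Θ³∕6` with `w₃ = 2v₃ + v₁³ − 3v₁v₂` (Newton's recursion; the Literature file's
«c₃(F) = (2v₃ + v₁³ − 3v₁v₂)·Θ³∕6»). [bookkeeping; transcription] -/
def chern3 (w : Fin 5 → ℤ) : ℤ := 2 * w 3 + w 1 ^ 3 - 3 * w 1 * w 2

/-- The forward orbit of a character vector under the two generators `T` (`⊗𝒪(Θ)`) and `Φ` (Fourier–Mukai) — the group «⟨P̄, J̄⟩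
(both involutions mod 2)» of (B-XIX)(a) read on integer vectors (forward closure suffices: mod 2 both generators are involutions).
A predicate of the finite model, not a fact. [bookkeeping; transcription] -/
inductive Reach : (Fin 5 → ℤ) → (Fin 5 → ℤ) → Prop
  | refl (v : Fin 5 → ℤ) : Reach v v
  | T {v u : Fin 5 → ℤ} : Reach v u → Reach v (T u)
  | Phi {v u : Fin 5 → ℤ} : Reach v u → Reach v (Phi u)

/-- The sieve is constant along `⟨T, Φ⟩`-orbits. [bookkeeping] -/
theorem sieve_of_reach {v u : Fin 5 → ℤ} (h : Reach v u) (hv : sieve v) : sieve u := by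
  induction h with
  | refl => exact hv
  | T _ ih => exact (sieve_T_iff _).mpr ih
  | Phi _ ih => exact (sieve_Phi_iff _).mpr ih

/-- Residue form of `chern_even_of_sieve`. [bookkeeping] -/
private theorem chern_aux : ∀ x1 x2 x3 : ZMod 2, x1 = x2 → x2 = x3 →
    (x1 * x1 - x2 = 0 ∧ 2 * x3 + x1 ^ 3 - 3 * x1 * x2 = 0) := by
  decide

/-- A sieved vector has EVEN codimension-2 and codimension-3 Chern coefficients `w₂`, `w₃` («w₃ ≡ w₂v₁ (mod 2) adds nothing»).
[bookkeeping] -/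
theorem chern_even_of_sieve (hw : sieve w) : chern2 w % 2 = 0 ∧ chern3 w % 2 = 0 := by
  rw [sieve_iff_cast] at hw
  rw [emod_two_eq_zero_iff_cast, emod_two_eq_zero_iff_cast]
  simp only [chern2, chern3]
  push_cast
  exact chern_aux _ _ _ hw.1 hw.2

/-- **(B-XIX)(a) at n = 4: the ORBIT DEFINITION of `𝒫₄` equals the closed form.** «𝒫_n := { v̄ : for every g in the group ⟨P̄, J̄⟩
the Chern coefficients w_c(g v̄), 2 ≤ c ≤ n−1, are even }» — at n = 4: `v` is sieved (`v₁ ≡ v₂ ≡ v₃`) iff EVERY vector in its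
`⟨T, Φ⟩`-orbit has even `w₂` and `w₃`. (⇒) orbit-constancy + `chern_even_of_sieve`; (⇐) already `w₂(v)` and `w₂(Φ v) = v₃² − v₂` even
suffice — this is the tree's `paritySieve_of_conjugates` («Generation of the sieve»). [bookkeeping; kernel form of (B-XIX)(a) at n = 4,
the generation step cited: `Literature.AlgebraicGeometry.HodgeTheory.paritySieve_of_conjugates`] -/
theorem sieve_iff_forall_reach_chern_even :
    sieve w ↔ ∀ u, Reach w u → (chern2 u % 2 = 0 ∧ chern3 u % 2 = 0) := by
  constructor
  · intro hw u hu
    exact chern_even_of_sieve _ (sieve_of_reach hu hw)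
  · intro h
    have h0 := (h w (Reach.refl w)).1
    have h1 := (h (Phi w) (Reach.Phi (Reach.refl w))).1
    simp only [chern2, Phi, Matrix.cons_val_zero, Matrix.cons_val_one, Matrix.head_cons, Matrix.cons_val_two,
      Matrix.tail_cons] at h0 h1
    rw [neg_mul_neg] at h1
    exact paritySieve_of_conjugates (w 1) (w 2) (w 3) h0 h1

/-! ### §1b Box cells ((B-XIX)(d)) -/

/-- **BOX CELL `pe(d)`:** `pe(d) = (1,0,−d,0,d²)` is sieved iff `d` is even («fails ⟺ d odd; c₂ = dΘ²∕2»). [bookkeeping] -/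
theorem sieve_pe_iff (d : ℤ) : sieve (pe d) ↔ d % 2 = 0 := by
  simp only [sieve, pe, Matrix.cons_val_zero, Matrix.cons_val_one, Matrix.head_cons, Matrix.cons_val_two,
    Matrix.tail_cons, Matrix.cons_val_three]
  omega

/-- **BOX CELL `po(d)`:** `po(d) = (0,1,0,−d,0)` is never sieved («v₁ = 1, v₂ = 0 ⇒ fails for every d»). [bookkeeping] -/
theorem not_sieve_po (d : ℤ) : ¬ sieve (po d) := by
  simp only [sieve, po, Matrix.cons_val_zero, Matrix.cons_val_one, Matrix.head_cons, Matrix.cons_val_two,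
    Matrix.tail_cons, Matrix.cons_val_three]
  omega

/-- Twisted box cell: `e^{aΘ} pe(d)` is sieved iff `d` is even, for every twist `a`. [bookkeeping] -/
theorem sieve_expPow_mul_pe_iff (c d : ℤ) : sieve (thetaMul (expPow c) (pe d)) ↔ d % 2 = 0 := by
  rw [sieve_expPow_mul_iff, sieve_pe_iff]

/-- Twisted box cell: `e^{aΘ} po(d)` is never sieved («fails for every d, every a»). [bookkeeping] -/
theorem not_sieve_expPow_mul_po (c d : ℤ) : ¬ sieve (thetaMul (expPow c) (po d)) := by
  rw [sieve_expPow_mul_iff]; exact not_sieve_po d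

/-- The `d = 1` instance in the text: at `d = 1` (the two `ℚ(i)` cells of (B-XVI)(g)) both `pe(1) = (1,0,−1,0,1)` and
`po(1) = (0,1,0,−1,0)` violate the sieve (t-19 g7 `boxCells_fail`). [bookkeeping] -/
theorem boxCells_d_one : ¬ sieve (pe 1) ∧ ¬ sieve (po 1) := by
  refine ⟨?_, not_sieve_po 1⟩
  rw [sieve_pe_iff]; decide

end OneFactor

end Summit.Ventures.HSemireg.ParitySieve
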